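import Summits.QuantumFields.YangMills.Theorems.BalabanUVNodesN08HaarCompatibilityGuardHybridPartition
import Summits.QuantumFields.YangMills.Theorems.BalabanUVNodesN08HaarCompatibilityGuardOneStepBound

/-!
# BalabanUVNodes ∕ N08 — THE TRANSPORTED GUARDED PART UNDER THE HYBRID AVERAGING `Ū^S`: MIXTURE NORMAL FORM, THE ONE-STEP DENSITY BOUND WITH EXPONENT `|S|`
# (not `#PBond(j+1)`), AND THE MASS (ACTIVITY) BOUND `h(δ)^{|S|(L^{d−1}−1)}` — the sup ∕ mass half of (G1)

WIDTH SEAT `pub-ymgap-dag-n08-w3` g7, item-3 lineage PART 36 (successor of part 34 `…GuardHybridPartition` and of parts 13∕16∕18∕19∕20: `…GuardMixture`,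
`…GuardMixtureDensity`, `…GuardCrossingJointLaw`, `…GuardAdmitting`, `…GuardOneStepBound`), 2026-08-28.  Track A, DAG node N08 = [Balaban1985UV3] Thm 1 p. 257
(compact) + Thm 2 p. 272; key item K1⁷ `StabilityBAtRecordR13SepCoPH` (stmt-QuantumFields-20542), `--supports … --as helper`.  COUNT-NEUTRAL.

THE POINT (located; n08-w1 g6's `N08-NO-STACKING-MECHANISM.md` §3 (G1), count-neutral).  In the positive polymer bound of part 34,
`μ∘Ū⁻¹ ≤ Σ_S (μ↾G_S)∘(Ū^S)⁻¹`, the summand of `S` is carried by the HYBRID averaging `Ū^S` (typed (0.4) on `S`, axial off `S`).  This file gives its SIZE: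
* §1 [folklore] the finset form of part 20's expansion: `h^{|S|}·∫ Π_{c∈S}(1 + a·1_{E_c}) dμ ≤ (h + a·t)^{|S|}` from the joint bounds `h^{|T|}·μ(∩_T E_c) ≤ t^{|T|}`.
* §2 `isLocal_hybrid`, ★ `map_hybrid_eq_map_resample` (MIXTURE NORMAL FORM: `Ū^S_*(dU)` is the law of the background-wise independent resampling
  `(U, g) ↦ (c ↦ Ū^S(c)(U[β(c) ↦ g_c]))` under `dU ⊗ Haar^{PBond(j+1)}` — part 13 for `Ū^S`), `map_hybrid_fibre_eq_haar_of_not_mem` (off `S` the fibre law is Haar EXACTLY),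
  ★★ `map_hybrid_le_lintegral_smul` (per-fibre domination `A c U` on `S` ⇒ `Ū^S_*(dU) ≤ (∫ Π_{c∈S} A c U dU) • dV`).
* §3 ★★★ `smul_map_hybrid_le` — **`h(δ′)^{|S|} • Ū^S_*(dU) ≤ (h(δ′) + (K−1)·h(δ+δ′)^{L^{d−1}−1})^{|S|} • dV`** under (H_K) for the bonds of `S` only: the one-step density
  of the hybrid transport is `≤ (1 + (K−1)s)^{|S|}`, `s = h(δ+δ′)^{L^{d−1}−1}∕h(δ′)` — exponent `|S|`, uniformly in the lattice; ★★ `smul_map_hybrid_le_of_le` (an input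
  `ν ≤ C • dU` is transported to `≤ C·(1 + (K−1)s)^{|S|} • dV`); ★★ `map_hybrid_restrict_guardAll_mass_le` — **the transported guarded part `(ν↾G_S)∘(Ū^S)⁻¹` has total
  mass `≤ C·h(δ)^{|S|(L^{d−1}−1)}`** (part 18's joint small-field bound): the ACTIVITY `q^{|S|}` of the polymer `S`.
* §4 the same at the [B10] slot's averaging `avOfPrint N S₀ j` on `SU(N)`, every `N`, standing range (`d = 3`: exponents `L² − 1`).
READING for road (ii) (located): with part 35's locality, `density(Ū_*(f·dU)) ≤ Σ_S B_S` with `B_S` local near `S`, `sup B_S ≤ C·(1 + (K−1)s)^{|S|}`, `∫ B_S ≤ C·q^{|S|}`.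

HONEST FRAMING.  [folklore] measure theory over pub-balaban's resampling lemma and this lineage's parts BY IMPORT; nothing of Bałaban's asserted; (H_K) is a HYPOTHESIS here
(discharged at `N = 2` on `L^{d−1} ≤ 400` by part 31, with ∃K for every `N` by n08-w6's `…GuardCoreLawSUN` — not restated); ONE RG step; no cluster expansion, no k-uniform
`hmass`; E6′ NOT decided; N08 NOT discharged; counts unmoved (typed 28∕28 · discharged 5∕27); one finite 𝕋⁴ programme at fixed ε — R4 closes the CONDITIONAL rung
`BalabanLadder.UV` only; the Yang–Mills mass gap (Clay) is NOT proved by any of this; nothing continuum ∕ ℝ⁴ ∕ OS.  0 `sorry`, 0 `def`, 0 `instance`, standard axioms.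
-/

noncomputable section

open MeasureTheory Function
open scoped ENNReal

namespace Summit.QuantumFields.YangMills.BalabanUVNodes.N08HaarCompatibilityGuardHybridDensity

open Literature.MathematicalPhysics.QuantumFieldTheory.Balaban1983to89
open Literature.MathematicalPhysics.QuantumFieldTheory.Balaban1983to89.AveragingRT (axialAvg measurable_axialAvg map_axialAvg)
open Literature.MathematicalPhysics.QuantumFieldTheory.Balaban1983to89.BlockAveraging (Idx loopHol Small avgFun measurable_avgFun off)
open Literature.MathematicalPhysics.QuantumFieldTheory.Balaban1983to89.BlockAveragingHaarAC
  (centralBond centralBond_injective IsCentral pre post axialAvg_update_centralBond axialAvg_update_centralBond_of_ne isLocal_avgFun)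
open Literature.MathematicalPhysics.QuantumFieldTheory.Balaban1983to89.T4TriangularPushforward (IsLocal measurePreserving_resample apply_resample_eq)
open Summit.QuantumFields.YangMills.BalabanUVNodes.N08HaarCompatibilityGuardHybridPartition (measurable_hybrid measurableSet_guardAll)
open Summit.QuantumFields.YangMills.BalabanUVNodes.N08HaarCompatibilityGuardMixtureDensity (map_prod_pi_le_lintegral_smul)
open Summit.QuantumFields.YangMills.BalabanUVNodes.N08HaarCompatibilityGuardAdmitting
  (measurable_haar_crossSmall_update setOf_exists_small_subset measure_forall_guardSharp_le)
open Summit.QuantumFields.YangMills.BalabanUVNodes.N08HaarCompatibilityGuardCrossingJointLaw (measure_forall_small_le_pow)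
open Summit.QuantumFields.YangMills.BalabanUVNodes.N08HaarCompatibilityGuardOneStepBound (prod_mul_indicator_one)

/-! ## §1 The finset form of the expansion bound -/

section Expansion

variable {X : Type*} [MeasurableSpace X] {ι : Type*} [Fintype ι] [DecidableEq ι]

/-- ★ **THE EXPANSION BOUND ON A FINSET**: for measurable events `E_c` with joint bounds `h^{|T|}·μ{∀ c ∈ T, E_c} ≤ t^{|T|}` for every `T ⊆ S`, and any `a`:
`h^{|S|}·∫ Π_{c∈S} (1 + a·1_{E_c}) dμ ≤ (h + a·t)^{|S|}` (`Π_{c∈S}(1 + a·1_{E_c}) = Σ_{T⊆S} a^{|T|}·1_{∩_T E_c}`, Mathlib `Finset.prod_add` twice; part 20's `S = univ` case verbatim). [folklore] -/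
theorem lintegral_finsetProd_one_add_indicator_le (μ : Measure X) (E : ι → Set X) (hE : ∀ c, MeasurableSet (E c)) (a h t : ℝ≥0∞) (S : Finset ι)
    (hjoint : ∀ T : Finset ι, T ⊆ S → h ^ T.card * μ {x : X | ∀ c ∈ T, x ∈ E c} ≤ t ^ T.card) :
    h ^ S.card * ∫⁻ x, ∏ c ∈ S, (1 + a * (E c).indicator (fun _ => (1 : ℝ≥0∞)) x) ∂μ ≤ (h + a * t) ^ S.card := by
  have hES : ∀ T : Finset ι, MeasurableSet {x : X | ∀ c ∈ T, x ∈ E c} := fun T => by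
    rw [show {x : X | ∀ c ∈ T, x ∈ E c} = ⋂ c ∈ T, E c by ext x; simp]
    exact T.measurableSet_biInter fun c _ => hE c
  have hmeasT : ∀ T : Finset ι, Measurable fun x => ∏ c ∈ T, a * (E c).indicator (fun _ => (1 : ℝ≥0∞)) x := fun T =>
    Finset.measurable_prod _ fun c _ => measurable_const.mul (measurable_const.indicator (hE c))
  -- expand the product over the bonds of `S`
  have hexp : ∀ x : X, ∏ c ∈ S, (1 + a * (E c).indicator (fun _ => (1 : ℝ≥0∞)) x) =
      ∑ T ∈ S.powerset, ∏ c ∈ T, a * (E c).indicator (fun _ => (1 : ℝ≥0∞)) x := by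
    intro x
    rw [Finset.prod_congr rfl fun c _ => add_comm (1 : ℝ≥0∞) _, Finset.prod_add]
    exact Finset.sum_congr rfl fun T _ => by rw [Finset.prod_const_one, mul_one]
  simp_rw [hexp]
  rw [lintegral_finsetSum _ fun T _ => hmeasT T, Finset.mul_sum]
  -- the binomial on the right
  have hrhs : (h + a * t) ^ S.card = ∑ T ∈ S.powerset, (a * t) ^ T.card * h ^ (S.card - T.card) := by
    rw [← Finset.prod_const, Finset.prod_congr rfl fun c _ => add_comm h (a * t), Finset.prod_add]
    refine Finset.sum_congr rfl fun T hT => ?_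
    rw [Finset.prod_const, Finset.prod_const, Finset.card_sdiff_of_subset (Finset.mem_powerset.1 hT)]
  rw [hrhs]
  refine Finset.sum_le_sum fun T hT => ?_
  have hTS : T ⊆ S := Finset.mem_powerset.1 hT
  have hcard : T.card ≤ S.card := Finset.card_le_card hTS
  rw [lintegral_congr fun x => prod_mul_indicator_one E a T x, lintegral_const_mul _ (measurable_const.indicator (hES T)),
    lintegral_indicator_const (hES T), one_mul]
  have hpow : h ^ S.card = h ^ (S.card - T.card) * h ^ T.card := by rw [← pow_add, Nat.sub_add_cancel hcard]
  calc h ^ S.card * (a ^ T.card * μ {x : X | ∀ c ∈ T, x ∈ E c})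
      = a ^ T.card * h ^ (S.card - T.card) * (h ^ T.card * μ {x : X | ∀ c ∈ T, x ∈ E c}) := by rw [hpow]; ring
    _ ≤ a ^ T.card * h ^ (S.card - T.card) * t ^ T.card := mul_le_mul' le_rfl (hjoint T hTS)
    _ = (a * t) ^ T.card * h ^ (S.card - T.card) := by rw [mul_pow]; ring

end Expansion

/-! ## §2 The mixture normal form of the hybrid transport and the per-fibre domination -/

section Mixture

variable {P : Params} {j : ℕ} {G : Type*} [GaugeGroup G] (ℰ : LoopAverage G) [DecidableEq (PBond P (j + 1))]

/-- **THE HYBRID AVERAGING IS LOCAL IN THE PRIVATE COORDINATES**: `Ū^S(c′)` does not see `U(β(c))` for `c ≠ c′` (standing range). [folklore] -/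
theorem isLocal_hybrid (hj : j + 1 ≤ P.m + P.K) (S : Finset (PBond P (j + 1))) :
    IsLocal (centralBond : PBond P (j + 1) → PBond P j)
      (fun U : GaugeField P j G => (fun c => if c ∈ S then avgFun ℰ U c else axialAvg U c : GaugeField P (j + 1) G)) := by
  classical
  intro U c g c' hc
  show (if c' ∈ S then avgFun ℰ (update U (centralBond c) g) c' else axialAvg (update U (centralBond c) g) c') =
    (if c' ∈ S then avgFun ℰ U c' else axialAvg U c')
  by_cases hc' : c' ∈ S
  · rw [if_pos hc', if_pos hc']
    exact isLocal_avgFun hj ℰ U c g c' hc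
  · rw [if_neg hc', if_neg hc', axialAvg_update_centralBond_of_ne hj U c c' hc g]

/-- **FOR `c ∉ S` THE FIBRE MAP IS THE TRANSLATION `g ↦ pre·g·post`**. [folklore] -/
theorem hybrid_fibre_of_not_mem (hj : j + 1 ≤ P.m + P.K) (S : Finset (PBond P (j + 1))) (U : GaugeField P j G) {c : PBond P (j + 1)} (hc : c ∉ S) (g : G) :
    (fun c' => if c' ∈ S then avgFun ℰ (update U (centralBond c) g) c' else axialAvg (update U (centralBond c) g) c' : GaugeField P (j + 1) G) c =
      pre U c * g * post U c := by
  classical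
  show (if c ∈ S then avgFun ℰ (update U (centralBond c) g) c else axialAvg (update U (centralBond c) g) c) = _
  rw [if_neg hc, axialAvg_update_centralBond hj]

variable [MeasurableSpace G] [RegularGaugeGroup G] [HaarData G]

/-- ★ **THE MIXTURE NORMAL FORM OF THE HYBRID TRANSPORT**: `(dU).map Ū^S = (dU ⊗ Haar^{PBond(j+1)}).map ((U, g) ↦ (c ↦ Ū^S(c)(U[β(c) ↦ g_c])))` — locality in the
private coordinates + pub-balaban's resampling lemma (part 13 verbatim for `Ū^S`). [cite: Balaban1987RG1, (0.4) p.253 (the typed averaging; bookkeeping)] -/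
theorem map_hybrid_eq_map_resample (hj : j + 1 ≤ P.m + P.K) (hE : ∀ n, Measurable fun W : Fin (n + 1) → G => ℰ.E W) (S : Finset (PBond P (j + 1))) :
    (fieldMeasure P j G).map (fun U : GaugeField P j G => (fun c => if c ∈ S then avgFun ℰ U c else axialAvg U c : GaugeField P (j + 1) G)) =
      ((fieldMeasure P j G).prod (Measure.pi fun _ : PBond P (j + 1) => (HaarData.haar : Measure G))).map
        (fun p : GaugeField P j G × (PBond P (j + 1) → G) => fun c =>
          (fun c' => if c' ∈ S then avgFun ℰ (update p.1 (centralBond c) (p.2 c)) c' else axialAvg (update p.1 (centralBond c) (p.2 c)) c' :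
            GaugeField P (j + 1) G) c) := by
  classical
  haveI := HaarData.isProb (G := G)
  have hA := isLocal_hybrid ℰ hj S
  have hβ := centralBond_injective (P := P) (j := j) hj
  have hres := measurePreserving_resample (ι := PBond P j) (HaarData.haar : Measure G) hβ
  have key : (fun p : GaugeField P j G × (PBond P (j + 1) → G) => fun c =>
        (fun c' => if c' ∈ S then avgFun ℰ (update p.1 (centralBond c) (p.2 c)) c' else axialAvg (update p.1 (centralBond c) (p.2 c)) c' :
          GaugeField P (j + 1) G) c) =
      (fun U : GaugeField P j G => (fun c => if c ∈ S then avgFun ℰ U c else axialAvg U c : GaugeField P (j + 1) G)) ∘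
        fun p : GaugeField P j G × (PBond P (j + 1) → G) => Function.extend centralBond p.2 p.1 :=
    funext fun p => funext fun c => (apply_resample_eq hA hβ p.1 p.2 c).symm
  have h2 := Measure.map_map (μ := (Measure.pi fun _ : PBond P j => (HaarData.haar : Measure G)).prod
    (Measure.pi fun _ : PBond P (j + 1) => (HaarData.haar : Measure G))) (measurable_hybrid ℰ hE S) hres.measurable
  rw [key]
  exact ((congrArg (fun ν : Measure (GaugeField P j G) => ν.map
    (fun U : GaugeField P j G => (fun c => if c ∈ S then avgFun ℰ U c else axialAvg U c : GaugeField P (j + 1) G))) hres.map_eq).symm.trans h2)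

omit [HaarData G] in
/-- The hybrid one-variable fibre map `(U, g) ↦ Ū^S(c)(U[β(c) ↦ g])` is jointly measurable. [folklore] -/
theorem measurable_hybrid_fibreMap (hE : ∀ n, Measurable fun W : Fin (n + 1) → G => ℰ.E W) (S : Finset (PBond P (j + 1))) (c : PBond P (j + 1)) :
    Measurable fun p : GaugeField P j G × G =>
      (fun c' => if c' ∈ S then avgFun ℰ (update p.1 (centralBond c) p.2) c' else axialAvg (update p.1 (centralBond c) p.2) c' : GaugeField P (j + 1) G) c := by
  classical
  exact (measurable_pi_apply c).comp ((measurable_hybrid ℰ hE S).comp measurable_update')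

/-- **OFF `S` THE FIBRE LAW IS HAAR EXACTLY**, every background: the image of Haar under `g ↦ pre·g·post`. [folklore] -/
theorem map_hybrid_fibre_eq_haar_of_not_mem (hj : j + 1 ≤ P.m + P.K) (S : Finset (PBond P (j + 1))) (U : GaugeField P j G) {c : PBond P (j + 1)} (hc : c ∉ S) :
    (HaarData.haar : Measure G).map (fun g =>
      (fun c' => if c' ∈ S then avgFun ℰ (update U (centralBond c) g) c' else axialAvg (update U (centralBond c) g) c' : GaugeField P (j + 1) G) c) =
      HaarData.haar := by
  have hfun : (fun g => (fun c' => if c' ∈ S then avgFun ℰ (update U (centralBond c) g) c' else axialAvg (update U (centralBond c) g) c' :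
      GaugeField P (j + 1) G) c) = fun g => pre U c * g * post U c := funext fun g => hybrid_fibre_of_not_mem ℰ hj S U hc g
  rw [hfun, show (fun g => pre U c * g * post U c) = (fun g => g * post U c) ∘ (fun g => pre U c * g) from rfl,
    ← Measure.map_map (measurable_mul_const _) (measurable_const_mul _), HaarData.map_mul_left, HaarData.map_mul_right]

/-- ★★ **PER-FIBRE DOMINATION ON `S` INTEGRATES TO A ONE-STEP BOUND FOR THE HYBRID TRANSPORT**: if for every background `U` and every `c ∈ S` the law of print's fibre map
`g ↦ Ū(c)(U[β(c) ↦ g])` is `≤ A c U • Haar` (`A c` measurable, values in `(0, ∞)`), then `Ū^S_*(dU) ≤ (∫⁻ Π_{c∈S} A c U dU) • dV` — the coordinates off `S` contribute the factor `1`.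
[cite: Balaban1987RG1, (0.4) p.253 (the typed averaging; bookkeeping)] -/
theorem map_hybrid_le_lintegral_smul (hj : j + 1 ≤ P.m + P.K) (hE : ∀ n, Measurable fun W : Fin (n + 1) → G => ℰ.E W) (S : Finset (PBond P (j + 1)))
    (A : PBond P (j + 1) → GaugeField P j G → ℝ≥0∞) (hAm : ∀ c, Measurable (A c)) (hA0 : ∀ c U, A c U ≠ 0) (hAtop : ∀ c U, A c U ≠ ∞)
    (hdom : ∀ c ∈ S, ∀ U : GaugeField P j G,
      (HaarData.haar : Measure G).map (fun g => avgFun ℰ (update U (centralBond c) g) c) ≤ A c U • (HaarData.haar : Measure G)) :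
    (fieldMeasure P j G).map (fun U : GaugeField P j G => (fun c => if c ∈ S then avgFun ℰ U c else axialAvg U c : GaugeField P (j + 1) G)) ≤
      (∫⁻ U, ∏ c ∈ S, A c U ∂(fieldMeasure P j G)) • fieldMeasure P (j + 1) G := by
  haveI := HaarData.isProb (G := G)
  set A' : PBond P (j + 1) → GaugeField P j G → ℝ≥0∞ := fun c U => if c ∈ S then A c U else 1 with hA'
  have hA'm : ∀ c, Measurable (A' c) := fun c => by
    by_cases hc : c ∈ S
    · simp only [hA', if_pos hc]; exact hAm c
    · simp only [hA', if_neg hc]; exact measurable_const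
  have hA'0 : ∀ c U, A' c U ≠ 0 := fun c U => by
    by_cases hc : c ∈ S
    · simp only [hA', if_pos hc]; exact hA0 c U
    · simp only [hA', if_neg hc]; exact one_ne_zero
  have hA'top : ∀ c U, A' c U ≠ ∞ := fun c U => by
    by_cases hc : c ∈ S
    · simp only [hA', if_pos hc]; exact hAtop c U
    · simp only [hA', if_neg hc]; exact ENNReal.one_ne_top
  have hdom' : ∀ (c : PBond P (j + 1)) (U : GaugeField P j G), (HaarData.haar : Measure G).map (fun g =>
      (fun c' => if c' ∈ S then avgFun ℰ (update U (centralBond c) g) c' else axialAvg (update U (centralBond c) g) c' : GaugeField P (j + 1) G) c) ≤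
        A' c U • (HaarData.haar : Measure G) := by
    intro c U
    by_cases hc : c ∈ S
    · have hA'c : A' c U = A c U := by simp only [hA', if_pos hc]
      have hfun : (fun g => (fun c' => if c' ∈ S then avgFun ℰ (update U (centralBond c) g) c' else axialAvg (update U (centralBond c) g) c' :
          GaugeField P (j + 1) G) c) = fun g => avgFun ℰ (update U (centralBond c) g) c := funext fun g => if_pos hc
      rw [hA'c, hfun]; exact hdom c hc U
    · have hA'c : A' c U = 1 := by simp only [hA', if_neg hc]
      rw [hA'c, one_smul]
      exact (map_hybrid_fibre_eq_haar_of_not_mem ℰ hj S U hc).le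
  have hprod : ∀ U : GaugeField P j G, ∏ c, A' c U = ∏ c ∈ S, A c U := by
    intro U
    rw [← Finset.prod_filter_mul_prod_filter_not Finset.univ (fun c => c ∈ S)]
    have h1 : Finset.univ.filter (fun c => c ∈ S) = S := by ext c; simp
    have h2 : ∏ c ∈ Finset.univ.filter (fun c => ¬ c ∈ S), A' c U = 1 :=
      Finset.prod_eq_one fun c hc => by simp only [Finset.mem_filter, Finset.mem_univ, true_and] at hc; simp only [hA', if_neg hc]
    rw [h1, h2, mul_one]
    exact Finset.prod_congr rfl fun c hc => by simp only [hA', if_pos hc]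
  rw [map_hybrid_eq_map_resample ℰ hj hE S]
  have h := map_prod_pi_le_lintegral_smul (fieldMeasure P j G) HaarData.haar HaarData.haar
    (fun c U g => (fun c' => if c' ∈ S then avgFun ℰ (update U (centralBond c) g) c' else axialAvg (update U (centralBond c) g) c' : GaugeField P (j + 1) G) c)
    (measurable_hybrid_fibreMap ℰ hE S) A' hA'm hA'0 hA'top hdom'
  simp_rw [hprod] at h
  exact h

end Mixture

/-! ## §3 The one-step density bound with exponent `|S|`; the transported guarded part: sup and mass -/

section Bounds

variable {P : Params} {j : ℕ} {G : Type*} [GaugeGroup G] (ℰ : LoopAverage G) [DecidableEq (PBond P (j + 1))] [MeasurableSpace G] [RegularGaugeGroup G]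
  [HaarData G]

/-- ★★★ **THE ONE-STEP DENSITY BOUND FOR THE HYBRID TRANSPORT, EXPONENT `|S|`**: for every small-loop average `ℰ` (radius `δ`), every finset `S` of coarse bonds, every `δ′`, and a
constant `K ∈ [1, ∞)` dominating print's guarded fibre laws at the bonds of `S` (H_K on `S`):
`h(δ′)^{|S|} • Ū^S_*(dU) ≤ (h(δ′) + (K − 1)·h(δ + δ′)^{L^{d−1}−1})^{|S|} • dV` — i.e. the density of `Ū^S_*(dU)` is at most `(1 + (K−1)·h(δ+δ′)^{L^{d−1}−1}∕h(δ′))^{|S|}`, uniformly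
in the lattice (part 20 is the case `S = PBond(j+1)` for print's `Ū`).  Standing range, every group. [cite: Balaban1987RG1, (0.4) p.253 (the typed averaging; bookkeeping — the bound is NOT in print)] -/
theorem smul_map_hybrid_le (hj : j + 1 ≤ P.m + P.K) (hE : ∀ n, Measurable fun W : Fin (n + 1) → G => ℰ.E W) (S : Finset (PBond P (j + 1))) {K : ℝ≥0∞}
    (hK1 : 1 ≤ K) (hKtop : K ≠ ∞)
    (hK : ∀ c ∈ S, ∀ U : GaugeField P j G, (∃ g : G, Small ℰ (update U (centralBond c) g) c) →
      (HaarData.haar : Measure G).map (fun g => avgFun ℰ (update U (centralBond c) g) c) ≤ K • (HaarData.haar : Measure G))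
    (δ' : ℝ) :
    (HaarData.haar : Measure G) {g : G | dist1 g < δ'} ^ S.card •
        (fieldMeasure P j G).map (fun U : GaugeField P j G => (fun c => if c ∈ S then avgFun ℰ U c else axialAvg U c : GaugeField P (j + 1) G)) ≤
      ((HaarData.haar : Measure G) {g : G | dist1 g < δ'} +
          (K - 1) * (HaarData.haar : Measure G) {g : G | dist1 g < ℰ.δ + δ'} ^ (P.L ^ (P.d - 1) - 1)) ^ S.card •
        fieldMeasure P (j + 1) G := by
  classical
  haveI := HaarData.isProb (G := G)
  -- part 19's measurable super-events and the weights `A_c = 1 + (K−1)·1[GA♯_c]`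
  set E : PBond P (j + 1) → Set (GaugeField P j G) := fun c =>
    {U | (HaarData.haar : Measure G) {g : G | dist1 g < δ'} ≤ (HaarData.haar : Measure G)
      {g : G | ∀ r : {r : Fin P.d → Fin P.L // off r c.dir = 0 ∧ ¬ IsCentral c (r, 1, 1)},
        dist1 (loopHol (update U (centralBond c) g) c (r.1, 1, 1)) < ℰ.δ + δ'}} with hEdef
  have hEm : ∀ c, MeasurableSet (E c) := fun c =>
    measurableSet_le measurable_const (measurable_haar_crossSmall_update c (ℰ.δ + δ'))
  set A : PBond P (j + 1) → GaugeField P j G → ℝ≥0∞ := fun c U => 1 + (K - 1) * (E c).indicator (fun _ => (1 : ℝ≥0∞)) U with hAdef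
  have hAm : ∀ c, Measurable (A c) := fun c =>
    show Measurable fun U => 1 + (K - 1) * (E c).indicator (fun _ => (1 : ℝ≥0∞)) U from
      ((measurable_const.indicator (hEm c)).const_mul (K - 1)).const_add 1
  have hA0 : ∀ c U, A c U ≠ 0 := fun c U => ne_of_gt (lt_of_lt_of_le zero_lt_one le_self_add)
  have hAtop : ∀ c U, A c U ≠ ∞ := fun c U => by
    refine ENNReal.add_ne_top.2 ⟨ENNReal.one_ne_top, ENNReal.mul_ne_top (ENNReal.sub_ne_top hKtop) ?_⟩
    by_cases hU : U ∈ E c <;> simp [Set.indicator, hU]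
  -- the per-fibre domination at the bonds of `S`
  have hdom : ∀ c ∈ S, ∀ U : GaugeField P j G,
      (HaarData.haar : Measure G).map (fun g => avgFun ℰ (update U (centralBond c) g) c) ≤ A c U • (HaarData.haar : Measure G) := by
    intro c hc U
    by_cases hga : ∃ g : G, Small ℰ (update U (centralBond c) g) c
    · have hUE : U ∈ E c := setOf_exists_small_subset ℰ hj c δ' hga
      have hAK : A c U = K := by
        show 1 + (K - 1) * (E c).indicator (fun _ => (1 : ℝ≥0∞)) U = K
        rw [Set.indicator_of_mem hUE, mul_one, add_tsub_cancel_of_le hK1]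
      rw [hAK]; exact hK c hc U hga
    · rw [N08HaarCompatibilityGuardOneStepBound.map_fibre_eq_haar_of_not_exists ℰ hj U c hga]
      refine Measure.le_iff.2 fun s _ => ?_
      rw [Measure.smul_apply, smul_eq_mul]
      calc (HaarData.haar : Measure G) s = 1 * (HaarData.haar : Measure G) s := (one_mul _).symm
        _ ≤ A c U * (HaarData.haar : Measure G) s := mul_le_mul' (show (1 : ℝ≥0∞) ≤ A c U from le_self_add) le_rfl
  have hmix := map_hybrid_le_lintegral_smul ℰ hj hE S A hAm hA0 hAtop hdom
  -- part 19: the joint bounds of the super-events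
  have hjoint : ∀ T : Finset (PBond P (j + 1)), T ⊆ S →
      (HaarData.haar : Measure G) {g : G | dist1 g < δ'} ^ T.card * fieldMeasure P j G {U : GaugeField P j G | ∀ c ∈ T, U ∈ E c} ≤
        ((HaarData.haar : Measure G) {g : G | dist1 g < ℰ.δ + δ'} ^ (P.L ^ (P.d - 1) - 1)) ^ T.card := by
    intro T _
    calc (HaarData.haar : Measure G) {g : G | dist1 g < δ'} ^ T.card * fieldMeasure P j G {U : GaugeField P j G | ∀ c ∈ T, U ∈ E c}
        ≤ (HaarData.haar : Measure G) {g : G | dist1 g < ℰ.δ + δ'} ^ (T.card * (P.L ^ (P.d - 1) - 1)) := measure_forall_guardSharp_le hj ℰ.δ δ' T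
      _ = _ := by rw [mul_comm, pow_mul]
  -- §1: the expansion on `S`
  have hexp := lintegral_finsetProd_one_add_indicator_le (fieldMeasure P j G) E hEm (K - 1) ((HaarData.haar : Measure G) {g : G | dist1 g < δ'})
    ((HaarData.haar : Measure G) {g : G | dist1 g < ℰ.δ + δ'} ^ (P.L ^ (P.d - 1) - 1)) S hjoint
  -- assembly, set by set
  refine Measure.le_iff.2 fun s hs => ?_
  have hmixs := hmix s
  simp only [Measure.smul_apply, smul_eq_mul] at hmixs ⊢
  calc (HaarData.haar : Measure G) {g : G | dist1 g < δ'} ^ S.card *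
        (fieldMeasure P j G).map (fun U : GaugeField P j G => (fun c => if c ∈ S then avgFun ℰ U c else axialAvg U c : GaugeField P (j + 1) G)) s
      ≤ (HaarData.haar : Measure G) {g : G | dist1 g < δ'} ^ S.card * ((∫⁻ U, ∏ c ∈ S, A c U ∂(fieldMeasure P j G)) * fieldMeasure P (j + 1) G s) :=
        mul_le_mul' le_rfl hmixs
    _ = (HaarData.haar : Measure G) {g : G | dist1 g < δ'} ^ S.card * (∫⁻ U, ∏ c ∈ S, A c U ∂(fieldMeasure P j G)) * fieldMeasure P (j + 1) G s := by
        rw [mul_assoc]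
    _ ≤ _ := mul_le_mul' hexp le_rfl

/-- ★★ **AN INPUT `ν ≤ C • dU` IS TRANSPORTED BY `Ū^S` TO `≤ C·(1 + (K−1)s)^{|S|} • dV`** (in the cleared-denominator form of `smul_map_hybrid_le`): the sup of the transported density
is at most `C` times the hybrid one-step constant with exponent `|S|`; in particular for the GUARDED PART `ν↾G_S` of any `ν ≤ C • dU` (`Measure.restrict_le_self`).
[cite: Balaban1987RG1, (0.4) p.253 (bookkeeping — the bound is NOT in print)] -/
theorem smul_map_hybrid_le_of_le (hj : j + 1 ≤ P.m + P.K) (hE : ∀ n, Measurable fun W : Fin (n + 1) → G => ℰ.E W) (S : Finset (PBond P (j + 1))) {K : ℝ≥0∞}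
    (hK1 : 1 ≤ K) (hKtop : K ≠ ∞)
    (hK : ∀ c ∈ S, ∀ U : GaugeField P j G, (∃ g : G, Small ℰ (update U (centralBond c) g) c) →
      (HaarData.haar : Measure G).map (fun g => avgFun ℰ (update U (centralBond c) g) c) ≤ K • (HaarData.haar : Measure G))
    (δ' : ℝ) {ν : Measure (GaugeField P j G)} {C : ℝ≥0∞} (hν : ν ≤ C • fieldMeasure P j G) :
    (HaarData.haar : Measure G) {g : G | dist1 g < δ'} ^ S.card •
        ν.map (fun U : GaugeField P j G => (fun c => if c ∈ S then avgFun ℰ U c else axialAvg U c : GaugeField P (j + 1) G)) ≤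
      (C * ((HaarData.haar : Measure G) {g : G | dist1 g < δ'} +
          (K - 1) * (HaarData.haar : Measure G) {g : G | dist1 g < ℰ.δ + δ'} ^ (P.L ^ (P.d - 1) - 1)) ^ S.card) •
        fieldMeasure P (j + 1) G := by
  have h1 : ν.map (fun U : GaugeField P j G => (fun c => if c ∈ S then avgFun ℰ U c else axialAvg U c : GaugeField P (j + 1) G)) ≤
      C • (fieldMeasure P j G).map (fun U : GaugeField P j G => (fun c => if c ∈ S then avgFun ℰ U c else axialAvg U c : GaugeField P (j + 1) G)) := by
    rw [← Measure.map_smul]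
    exact Measure.map_mono hν (measurable_hybrid ℰ hE S)
  have h2 := smul_map_hybrid_le ℰ hj hE S hK1 hKtop hK δ'
  rw [Measure.le_iff]
  intro s hs
  have h1s := Measure.le_iff.1 h1 s hs
  have h2s := Measure.le_iff.1 h2 s hs
  simp only [Measure.smul_apply, smul_eq_mul] at h1s h2s ⊢
  calc (HaarData.haar : Measure G) {g : G | dist1 g < δ'} ^ S.card *
        ν.map (fun U : GaugeField P j G => (fun c => if c ∈ S then avgFun ℰ U c else axialAvg U c : GaugeField P (j + 1) G)) s
      ≤ (HaarData.haar : Measure G) {g : G | dist1 g < δ'} ^ S.card *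
          (C * (fieldMeasure P j G).map (fun U : GaugeField P j G => (fun c => if c ∈ S then avgFun ℰ U c else axialAvg U c : GaugeField P (j + 1) G)) s) :=
        mul_le_mul' le_rfl h1s
    _ = C * ((HaarData.haar : Measure G) {g : G | dist1 g < δ'} ^ S.card *
          (fieldMeasure P j G).map (fun U : GaugeField P j G => (fun c => if c ∈ S then avgFun ℰ U c else axialAvg U c : GaugeField P (j + 1) G)) s) := by ring
    _ ≤ C * (((HaarData.haar : Measure G) {g : G | dist1 g < δ'} +
          (K - 1) * (HaarData.haar : Measure G) {g : G | dist1 g < ℰ.δ + δ'} ^ (P.L ^ (P.d - 1) - 1)) ^ S.card * fieldMeasure P (j + 1) G s) :=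
        mul_le_mul' le_rfl h2s
    _ = C * ((HaarData.haar : Measure G) {g : G | dist1 g < δ'} +
          (K - 1) * (HaarData.haar : Measure G) {g : G | dist1 g < ℰ.δ + δ'} ^ (P.L ^ (P.d - 1) - 1)) ^ S.card * fieldMeasure P (j + 1) G s :=
        (mul_assoc _ _ _).symm

omit [DecidableEq (PBond P (j + 1))] in
/-- ★★ **THE MASS OF THE GUARDED PART IS THE ACTIVITY `q^{|S|}`**: `ν(G_S) ≤ C·h(δ)^{|S|·(L^{d−1}−1)}` for `ν ≤ C • dU` (part 18). [cite: Balaban1987RG1, (0.4) p.253 (bookkeeping)] -/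
theorem measure_guardAll_le_of_le (hj : j + 1 ≤ P.m + P.K) (S : Finset (PBond P (j + 1))) {ν : Measure (GaugeField P j G)} {C : ℝ≥0∞}
    (hν : ν ≤ C • fieldMeasure P j G) :
    ν {U : GaugeField P j G | ∀ c ∈ S, Small ℰ U c} ≤ C * (HaarData.haar : Measure G) {g : G | dist1 g < ℰ.δ} ^ (S.card * (P.L ^ (P.d - 1) - 1)) := by
  have h := hν {U : GaugeField P j G | ∀ c ∈ S, Small ℰ U c}
  rw [Measure.smul_apply, smul_eq_mul] at h
  exact h.trans (mul_le_mul' le_rfl (measure_forall_small_le_pow ℰ hj S))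

/-- ★★ **THE TRANSPORTED GUARDED PART HAS TOTAL MASS AT MOST THE ACTIVITY**: `((ν↾G_S)∘(Ū^S)⁻¹)(univ) = ν(G_S) ≤ C·h(δ)^{|S|·(L^{d−1}−1)}` for `ν ≤ C • dU`.
[cite: Balaban1987RG1, (0.4) p.253 (bookkeeping)] -/
theorem map_hybrid_restrict_guardAll_mass_le (hj : j + 1 ≤ P.m + P.K) (hE : ∀ n, Measurable fun W : Fin (n + 1) → G => ℰ.E W) (S : Finset (PBond P (j + 1)))
    {ν : Measure (GaugeField P j G)} {C : ℝ≥0∞} (hν : ν ≤ C • fieldMeasure P j G) :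
    (ν.restrict {U : GaugeField P j G | ∀ c ∈ S, Small ℰ U c}).map
        (fun U : GaugeField P j G => (fun c => if c ∈ S then avgFun ℰ U c else axialAvg U c : GaugeField P (j + 1) G)) Set.univ ≤
      C * (HaarData.haar : Measure G) {g : G | dist1 g < ℰ.δ} ^ (S.card * (P.L ^ (P.d - 1) - 1)) := by
  rw [Measure.map_apply (measurable_hybrid ℰ hE S) MeasurableSet.univ, Set.preimage_univ, Measure.restrict_apply_univ]
  exact measure_guardAll_le_of_le ℰ hj S hν

end Bounds

/-! ## §4 At the [B10] slot's averaging `avOfPrint N S₀ j` on `SU(N)` -/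

section Slot

open Literature.MathematicalPhysics.QuantumFieldTheory.Balaban1985CMP102.Setting (Scales)
open Literature.MathematicalPhysics.QuantumFieldTheory.Balaban1983to89.ExpMeanLog (expMeanLogSU expMeanLogSU_δ measurable_expMeanLogSU_E)
open Literature.MathematicalPhysics.QuantumFieldTheory.Balaban1983to89.Node00 (SU)

variable (N : ℕ) [NeZero N] {L : ℕ}

/-- ★★★ **AT THE SLOT** (the printed exp-mean-log guard of radius `δ_N = min(1∕3, π∕N)` on `SU(N)`, every `N`, standing range; `d = 3` so the exponent is `L² − 1`): under (H_K) at the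
bonds of `S`, `h(δ′)^{|S|} • Ū^S_*(dU) ≤ (h(δ′) + (K−1)·h(δ_N + δ′)^{L^{d−1}−1})^{|S|} • dV` for the hybrid of print's averaging on `S` and the axial averaging off `S`.
[cite: Balaban1985UV3, (2) p.256; Balaban1985Averaging, (15) p.19; Balaban1987RG1, (0.4) p.253 (bookkeeping — the bound is NOT in print)] -/
theorem smul_map_hybrid_avOfPrint_le (S₀ : Scales L) {j : ℕ} (hj : j + 1 ≤ S₀.P.m + S₀.P.K) [DecidableEq (PBond S₀.P (j + 1))] (S : Finset (PBond S₀.P (j + 1)))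
    {K : ℝ≥0∞} (hK1 : 1 ≤ K) (hKtop : K ≠ ∞)
    (hK : ∀ c ∈ S, ∀ U : GaugeField S₀.P j (SU N),
      (∃ g : SU N, Small (expMeanLogSU : LoopAverage (SU N)) (update U (centralBond c) g) c) →
        (HaarData.haar : Measure (SU N)).map (fun g => avgFun (expMeanLogSU : LoopAverage (SU N)) (update U (centralBond c) g) c) ≤
          K • (HaarData.haar : Measure (SU N)))
    (δ' : ℝ) :
    (HaarData.haar : Measure (SU N)) {g : SU N | dist1 g < δ'} ^ S.card •
        (fieldMeasure S₀.P j (SU N)).map (fun U : GaugeField S₀.P j (SU N) =>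
          (fun c => if c ∈ S then avgFun (expMeanLogSU : LoopAverage (SU N)) U c else axialAvg U c : GaugeField S₀.P (j + 1) (SU N))) ≤
      ((HaarData.haar : Measure (SU N)) {g : SU N | dist1 g < δ'} +
          (K - 1) * (HaarData.haar : Measure (SU N)) {g : SU N | dist1 g < min (1 / 3) (Real.pi / N) + δ'} ^ (S₀.P.L ^ (S₀.P.d - 1) - 1)) ^ S.card •
        fieldMeasure S₀.P (j + 1) (SU N) := by
  have h := smul_map_hybrid_le (expMeanLogSU : LoopAverage (SU N)) hj measurable_expMeanLogSU_E S hK1 hKtop hK δ'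
  rw [expMeanLogSU_δ, Fintype.card_fin] at h
  exact h

/-- ★★ **AT THE SLOT, THE GUARDED PART'S MASS**: for `ν ≤ C • dU`, the part of `ν` on which all bonds of `S` are guarded by the printed exp-mean-log guard, transported by the hybrid
averaging, has total mass `≤ C·Haar_{SU(N)}{‖W−1‖ < min(1∕3, π∕N)}^{|S|·(L^{d−1}−1)}`, every `N`. [cite: Balaban1985UV3, (2) p.256; Balaban1987RG1, (0.4) p.253 (bookkeeping)] -/
theorem map_hybrid_restrict_guardAll_avOfPrint_mass_le (S₀ : Scales L) {j : ℕ} (hj : j + 1 ≤ S₀.P.m + S₀.P.K) [DecidableEq (PBond S₀.P (j + 1))]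
    (S : Finset (PBond S₀.P (j + 1))) {ν : Measure (GaugeField S₀.P j (SU N))} {C : ℝ≥0∞} (hν : ν ≤ C • fieldMeasure S₀.P j (SU N)) :
    (ν.restrict {U : GaugeField S₀.P j (SU N) | ∀ c ∈ S, Small (expMeanLogSU : LoopAverage (SU N)) U c}).map
        (fun U : GaugeField S₀.P j (SU N) =>
          (fun c => if c ∈ S then avgFun (expMeanLogSU : LoopAverage (SU N)) U c else axialAvg U c : GaugeField S₀.P (j + 1) (SU N))) Set.univ ≤
      C * (HaarData.haar : Measure (SU N)) {g : SU N | dist1 g < min (1 / 3) (Real.pi / N)} ^ (S.card * (S₀.P.L ^ (S₀.P.d - 1) - 1)) := by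
  have h := map_hybrid_restrict_guardAll_mass_le (expMeanLogSU : LoopAverage (SU N)) hj measurable_expMeanLogSU_E S hν
  rw [expMeanLogSU_δ, Fintype.card_fin] at h
  exact h

end Slot

end Summit.QuantumFields.YangMills.BalabanUVNodes.N08HaarCompatibilityGuardHybridDensity

end
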